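import Summits.RiemannHypothesis.RiemannHypothesis.Theorems.SignConeConeMagnificationStubCombZeroSide
import Summits.RiemannHypothesis.RiemannHypothesis.Theorems.SignConeConeMagnificationTypeConvergence
import Literature.NumberTheory.LFunctions.WeilCombTwoPointSummable
import Literature.NumberTheory.LFunctions.WeilCombNodeForm
import Literature.NumberTheory.LFunctions.WeilCombAutocorrelationBump

/-!
# Stub `stub_combLocal` of line `Sketch` for crux `SignCone.ConeMagnification` — the glue
(item stmt-RiemannHypothesis-16303, route route-RiemannHypothesis-SignCone)

LOCAL SUMMABILITY `Σ_{p ∣ n} c(n)/n < ∞` FOR UNIT-SLACK WEIGHTS, assembled from the line lead's comb machinery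
(all in the tree): for a prime `p`, the two-point design `α = 𝟙_{{1,p}}` and a real nonnegative bump `b`
(`exists_real_bump`, autocorrelation package `autocorr_package`), unit slack at the `ζ`-mollified comb `g_M`
(window `κ/M`, `κ = √(log M)`) minus the landed comb zero-side lemma (`stub_combZeroSide`, p140318, with `ε = 1`)
gives `Re P_c(K) − Re P_Λ(K) ≤ 2‖g‖₂²`; the node forms `comb_prime_sum_re` / `comb_norm_sq` (p144291) turn this
into the COMB INEQUALITY `Σ_{(ℓ,ℓ') ∈ {1,p}²} (E_c − E_Λ)(ℓ,ℓ') ≤ Σ V_{ℓℓ'}(1)` of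
`summable_of_comb_inequalities` (p146444), whose other inputs are Chebyshev and the bounded Mertens difference
(from the hypothesis `hM` = `stub_fakeMertens`).

* `comb_inequality_of_unitSlack` — the comb inequality for all `M ≥ max(M₀, 4096p²)`;
* `stub_combLocal` — the registered stub, verbatim.
-/

noncomputable section

-- `Summit.RiemannHypothesis.RiemannHypothesis.…` repeats a namespace component by design (D-0017 layout).
set_option linter.dupNamespace false

open scoped BigOperators ComplexConjugate Topology ArithmeticFunction.vonMangoldt ContDiff
open Complex MeasureTheory Set Filter

namespace Summit.RiemannHypothesis.RiemannHypothesis.Theorems.SignConeConeMagnification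

open Literature.NumberTheory.LFunctions
open Summit.RiemannHypothesis.RiemannHypothesis.Theorems.SignCone

/-! ## Chebyshev and Mertens in the form of the comb lemmas -/

/-- Chebyshev along the integers. [folklore] -/
theorem chebyshev_nat {c : ℕ → ℝ} {A : ℝ} (hA : ∀ x : ℝ, 1 ≤ x → ∑ n ∈ Finset.Icc 1 ⌊x⌋₊, c n ≤ A * x) :
    ∀ N : ℕ, 1 ≤ N → ∑ n ∈ Finset.Icc 1 N, c n ≤ A * N := by
  intro N hN
  have := hA N (by exact_mod_cast hN)
  rwa [Nat.floor_natCast] at this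

/-- A convergent Mertens difference is bounded: `|Σ_{n ≤ N} (c(n) − Λ(n))/n| ≤ T₀` for all `N`. [folklore] -/
theorem exists_abs_dwtSum_le (c : ℕ → ℝ)
    (hM : ∃ C : ℝ, Tendsto (fun x : ℝ => (∑ n ∈ Finset.Icc 1 ⌊x⌋₊, c n / n) - Real.log x) atTop (𝓝 C)) :
    ∃ T₀ : ℝ, ∀ N : ℕ, |∑ n ∈ Finset.Icc 1 N, (c n - Λ n) / n| ≤ T₀ := by
  obtain ⟨S, hS⟩ := TypeIneq.tendsto_dwtSum c hM
  have h := hS.comp tendsto_natCast_atTop_atTop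
  obtain ⟨K, hK⟩ := isBounded_iff_forall_norm_le.1 (Metric.isBounded_range_of_tendsto _ h)
  refine ⟨K, fun N => ?_⟩
  have := hK _ ⟨N, rfl⟩
  simpa only [Function.comp_apply, Nat.floor_natCast, Real.norm_eq_abs] using this

/-! ## The comb inequality from unit slack -/

/-- **The comb inequality of the design `δ₁ + δ_p` from unit slack.**  For `c` with unit slack against every
Weil test, a prime `p` and a smooth real bump `b` supported in `[-1, 1]`: for all `M ≥ max(M₀, 4096p²)` the node sums
of the `ζ`-mollified two-point comb with window `√(log M)/M` satisfy
`Σ_{(ℓ,ℓ')} (E_c − E_Λ)(ℓ,ℓ') ≤ Σ_{(ℓ,ℓ')} V_{ℓℓ'}(1)` (unit slack minus the comb zero-side lemma with `ε = 1`,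
divided by the node forms of `Re P` and `‖g‖²`). [folklore] -/
theorem comb_inequality_of_unitSlack (c : ℕ → ℝ)
    (hU : ∀ g : ℝ → ℂ, IsWeilTest g →
      -(∫ t, ‖g t‖ ^ 2) ≤
        (weilPolarTerm (weilConv g (weilReflect g)) + weilArchTerm (weilConv g (weilReflect g)) -
          ∑' n : ℕ, ((c n : ℝ) : ℂ) / (Real.sqrt n : ℂ) *
            (weilConv g (weilReflect g) (Real.log n) + weilConv g (weilReflect g) (-Real.log n))).re)
    {p : ℕ} (hp : p.Prime) {b : ℝ → ℝ} (hb : ContDiff ℝ ∞ b) (hbc : HasCompactSupport b)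
    (hbs : tsupport b ⊆ Icc (-1) 1) :
    ∃ M₁ : ℕ, ∀ M : ℕ, M₁ ≤ M → ∀ V : ℕ → ℕ → ℕ → ℝ,
      (∀ ℓ ℓ' n : ℕ, V ℓ ℓ' n = ∑ k' ∈ Finset.Icc 1 M,
        (∑ k ∈ Finset.Icc 1 M, (∫ u, b u * b (u - ((Real.log ((n : ℝ) * ℓ' * k' / ℓ) - Real.log k)
            / (Real.sqrt (Real.log M) / M)))) / Real.sqrt k) / Real.sqrt k' / Real.sqrt n) →
      (∑ n ∈ Finset.Icc 1 (3 * p * M), c n * V 1 1 n - ∑ n ∈ Finset.Icc 1 (3 * p * M), (Λ n : ℝ) * V 1 1 n)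
        + (∑ n ∈ Finset.Icc 1 (3 * p * M), c n * V 1 p n - ∑ n ∈ Finset.Icc 1 (3 * p * M), (Λ n : ℝ) * V 1 p n)
        + (∑ n ∈ Finset.Icc 1 (3 * p * M), c n * V p 1 n - ∑ n ∈ Finset.Icc 1 (3 * p * M), (Λ n : ℝ) * V p 1 n)
        + (∑ n ∈ Finset.Icc 1 (3 * p * M), c n * V p p n - ∑ n ∈ Finset.Icc 1 (3 * p * M), (Λ n : ℝ) * V p p n)
        ≤ V 1 1 1 + V 1 p 1 + V p 1 1 + V p p 1 := by
  have hp2 : 2 ≤ p := hp.two_le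
  have hp1 : 1 ≤ p := hp.one_lt.le
  -- the two-point design
  set α : ℕ → ℝ := fun ℓ => if ℓ = 1 ∨ ℓ = p then 1 else 0 with hαdef
  have hα : ∀ m, p < m → α m = 0 := fun m hm => by
    simp only [hαdef]
    rw [if_neg]
    omega
  -- the complexified bump
  set b₁ : ℝ → ℂ := fun t => ((b t : ℝ) : ℂ) with hb₁
  have hb₁W : IsWeilTest b₁ :=
    ⟨Complex.ofRealCLM.contDiff.comp hb, hbc.comp_left Complex.ofReal_zero⟩
  have hsupp₁ : tsupport b₁ ⊆ Icc (-1) 1 := by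
    refine (closure_mono fun t ht => ?_).trans hbs
    simp only [Function.mem_support, hb₁, ne_eq, Complex.ofReal_eq_zero] at ht ⊢
    exact ht
  -- the zero side with `ε = 1`
  obtain ⟨M₀, hM₀⟩ := stub_combZeroSide α p hα b₁ hb₁W hsupp₁ (1 / 2) (by norm_num) (by norm_num) 1 one_pos
  refine ⟨max M₀ (4096 * p ^ 2), fun M hM V hV => ?_⟩
  have hMM₀ : M₀ ≤ M := le_of_max_le_left hM
  have hM4096 : 4096 * p ^ 2 ≤ M := le_of_max_le_right hM
  obtain ⟨hlog1, hκ1, -, hh0, hhp, hhM1, hhM2, hh2, -, -, -⟩ := comb_params_of_large hp1 hM4096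
  set κ : ℝ := Real.sqrt (Real.log M) with hκ
  have hκ0 : 0 < κ := by linarith
  have hMpos : 0 < M := by
    have : 1 ≤ 4096 * p ^ 2 := by nlinarith
    omega
  have hMR : (0 : ℝ) < M := by exact_mod_cast hMpos
  have hκeq : Real.log M ^ (1 / 2 : ℝ) = κ := by rw [hκ, Real.sqrt_eq_rpow]
  -- the comb
  set g : ℝ → ℂ := fun u => ∑ m ∈ Finset.range (p * M + 1),
    ((∑ k ∈ (Nat.divisors m).filter (· ≤ M), α (m / k) / Real.sqrt k : ℝ) : ℂ) *
      b₁ ((u - Real.log m) * (M : ℝ) / κ) with hgdef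
  have hgW : IsWeilTest g := by
    have hform : g = fun u => ∑ m ∈ Finset.range (p * M + 1),
        ((∑ k ∈ (Nat.divisors m).filter (· ≤ M), α (m / k) / Real.sqrt k : ℝ) : ℂ) *
          b₁ ((u - Real.log m) * ((M : ℝ) / κ)) := by
      funext u
      simp only [hgdef, mul_div_assoc]
    rw [hform]
    exact isWeilTest_logComb hb₁W _ _ (div_pos hMR hκ0).ne'
  -- zero side at this `M`
  have hZ : |(weilPolarTerm (weilConv g (weilReflect g)) + weilArchTerm (weilConv g (weilReflect g)) -
      ∑' n : ℕ, ((ArithmeticFunction.vonMangoldt n : ℝ) : ℂ) / (Real.sqrt n : ℂ) *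
        (weilConv g (weilReflect g) (Real.log n) + weilConv g (weilReflect g) (-Real.log n))).re| ≤
      1 * ∫ u, ‖g u‖ ^ 2 := by
    have := hM₀ M hMM₀
    simpa only [hκeq] using this
  -- unit slack at this comb
  have hUS := hU g hgW
  -- node forms
  have hgform : g = fun u => ∑ m ∈ Finset.range (p * M + 1),
      ((∑ k ∈ (Nat.divisors m).filter (· ≤ M), α (m / k) / Real.sqrt k : ℝ) : ℂ) *
        ((b ((u - Real.log m) * (M : ℝ) / κ) : ℝ) : ℂ) := by
    funext u
    simp only [hgdef, hb₁]
  have hPc := comb_prime_sum_re hα hp1 hb.continuous hbc hbs hMpos hκ0 hh2 c (N := 3 * p * M) le_rfl g hgform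
  have hPΛ := comb_prime_sum_re hα hp1 hb.continuous hbc hbs hMpos hκ0 hh2
    (fun n => (Λ n : ℝ)) (N := 3 * p * M) le_rfl g hgform
  have hnorm := comb_norm_sq hα hb.continuous hbc hMpos hκ0 g hgform
  -- combine: `Re P_c − Re P_Λ ≤ 2 ‖g‖²`
  have hdiff : (∑' n : ℕ, ((c n : ℝ) : ℂ) / (Real.sqrt n : ℂ) *
        (weilConv g (weilReflect g) (Real.log n) + weilConv g (weilReflect g) (-Real.log n))).re -
      (∑' n : ℕ, ((Λ n : ℝ) : ℂ) / (Real.sqrt n : ℂ) *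
        (weilConv g (weilReflect g) (Real.log n) + weilConv g (weilReflect g) (-Real.log n))).re ≤
      2 * ∫ u, ‖g u‖ ^ 2 := by
    have h1 := (abs_le.1 hZ).2
    rw [Complex.sub_re] at hUS h1
    linarith
  rw [hPc, hPΛ, hnorm] at hdiff
  -- divide by `2κ/M > 0` and expand the design
  have hκM : 0 < κ / M := div_pos hκ0 hMR
  set F : ℕ → ℕ → ℝ := fun ℓ ℓ' => ∑ n ∈ Finset.Icc 1 (3 * p * M), c n *
      ∑ k' ∈ Finset.Icc 1 M,
        (∑ k ∈ Finset.Icc 1 M, (∫ u, b u * b (u - (Real.log ((n : ℝ) * ℓ' * k' / ℓ) - Real.log k) / (κ / M)))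
            / Real.sqrt k) / Real.sqrt k' / Real.sqrt n with hF
  set G : ℕ → ℕ → ℝ := fun ℓ ℓ' => ∑ n ∈ Finset.Icc 1 (3 * p * M), (Λ n : ℝ) *
      ∑ k' ∈ Finset.Icc 1 M,
        (∑ k ∈ Finset.Icc 1 M, (∫ u, b u * b (u - (Real.log ((n : ℝ) * ℓ' * k' / ℓ) - Real.log k) / (κ / M)))
            / Real.sqrt k) / Real.sqrt k' / Real.sqrt n with hG
  set W : ℕ → ℕ → ℝ := fun ℓ ℓ' => ∑ k' ∈ Finset.Icc 1 M,
        (∑ k ∈ Finset.Icc 1 M, (∫ u, b u * b (u - (Real.log (((1 : ℕ) : ℝ) * ℓ' * k' / ℓ) - Real.log k) / (κ / M)))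
            / Real.sqrt k) / Real.sqrt k' / Real.sqrt ((1 : ℕ) : ℝ) with hW
  have hF2 := sum_design_two hp2 F
  have hG2 := sum_design_two hp2 G
  have hW2 := sum_design_two hp2 W
  have hdiff' : 2 * (κ / M) * (∑ ℓ ∈ Finset.Icc 1 p, ∑ ℓ' ∈ Finset.Icc 1 p, α ℓ * α ℓ' * F ℓ ℓ') -
      2 * (κ / M) * (∑ ℓ ∈ Finset.Icc 1 p, ∑ ℓ' ∈ Finset.Icc 1 p, α ℓ * α ℓ' * G ℓ ℓ') ≤
      2 * (κ / M * ∑ ℓ ∈ Finset.Icc 1 p, ∑ ℓ' ∈ Finset.Icc 1 p, α ℓ * α ℓ' * W ℓ ℓ') := by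
    simpa only [hF, hG, hW] using hdiff
  simp only [hαdef] at hdiff'
  rw [hF2, hG2, hW2] at hdiff'
  have hkey : (F 1 1 + F 1 p + F p 1 + F p p) - (G 1 1 + G 1 p + G p 1 + G p p) ≤ W 1 1 + W 1 p + W p 1 + W p p := by
    have h2 : 0 < 2 * (κ / M) := by positivity
    have := hdiff'
    rw [← mul_sub, show 2 * (κ / M * (W 1 1 + W 1 p + W p 1 + W p p)) =
      2 * (κ / M) * (W 1 1 + W 1 p + W p 1 + W p p) by ring] at this
    exact le_of_mul_le_mul_left this h2
  -- identify with `V`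
  have hVF : ∀ ℓ ℓ' : ℕ, ∑ n ∈ Finset.Icc 1 (3 * p * M), c n * V ℓ ℓ' n = F ℓ ℓ' := fun ℓ ℓ' => by
    simp only [hF, hV]
  have hVG : ∀ ℓ ℓ' : ℕ, ∑ n ∈ Finset.Icc 1 (3 * p * M), (Λ n : ℝ) * V ℓ ℓ' n = G ℓ ℓ' := fun ℓ ℓ' => by
    simp only [hG, hV]
  have hVW : ∀ ℓ ℓ' : ℕ, V ℓ ℓ' 1 = W ℓ ℓ' := fun ℓ ℓ' => by
    simp only [hW, hV]
  simp only [hVF, hVG, hVW]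
  linarith

/-! ## The stub -/

/-- **Stub E — `combLocal` (unit slack + Chebyshev/Mertens ⟹ `Σ_{p ∣ n} c(n)/n < ∞` for every prime `p`).**
For `c ≥ 0`, `c 1 = 0`, with unit slack against every Weil test, Chebyshev and Mertens (outputs of `stub_fakeMertens`):
the comb inequalities of the design `δ₁ + δ_p` (`comb_inequality_of_unitSlack`: unit slack at the `ζ`-mollified
two-point comb minus the landed comb zero-side lemma, in node form) feed the lead's
`summable_of_comb_inequalities` (the two-point extraction: every term but the divergent one is `O(log M)` while
`Σ_{n ≤ √Y_M, p ∣ n} c(n)/n` carries `log Y_M ≥ (log M)/2`), with Chebyshev `A₁`, the bounded Mertens difference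
`T₀` and the autocorrelation package of a real nonnegative bump. [folklore] -/
theorem stub_combLocal :
    ∀ c : ℕ → ℝ, (∀ n, 0 ≤ c n) → c 1 = 0 →
      (∀ g : ℝ → ℂ, IsWeilTest g →
        -(∫ t, ‖g t‖ ^ 2) ≤
          (weilPolarTerm (weilConv g (weilReflect g)) + weilArchTerm (weilConv g (weilReflect g)) -
            ∑' n : ℕ, ((c n : ℝ) : ℂ) / (Real.sqrt n : ℂ) *
              (weilConv g (weilReflect g) (Real.log n) + weilConv g (weilReflect g) (-Real.log n))).re) →
      ((∃ A : ℝ, ∀ x : ℝ, 1 ≤ x → ∑ n ∈ Finset.Icc 1 ⌊x⌋₊, c n ≤ A * x) ∧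
        (∃ C : ℝ, Filter.Tendsto (fun x : ℝ => (∑ n ∈ Finset.Icc 1 ⌊x⌋₊, c n / n) - Real.log x)
          Filter.atTop (nhds C))) →
      (∀ p : ℕ, p.Prime → Summable (fun n : ℕ => if p ∣ n then c n / n else 0)) := by
  intro c hc0 _ hU hM p hp
  obtain ⟨⟨A, hA⟩, hMer⟩ := hM
  obtain ⟨b, hb, hbc, hbs, hb0, -, hbpos⟩ := exists_real_bump
  obtain ⟨N₀, N₁, N₂, hB, hB', h0, h1, h2, hBs, hB0⟩ := autocorr_package hb hbc hbs hb0
  have hBpos : 0 < (fun v => ∫ u, b u * b (u - v)) 0 := by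
    show 0 < ∫ u, b u * b (u - 0)
    rw [autocorr_zero]
    exact hbpos
  obtain ⟨T₀, hT⟩ := exists_abs_dwtSum_le c hMer
  obtain ⟨M₁, hcomb⟩ := comb_inequality_of_unitSlack c hU hp hb hbc hbs
  exact summable_of_comb_inequalities hB hB' h0 h1 h2 hBs hB0 hBpos hp hc0 (chebyshev_nat hA) hT ⟨M₁, hcomb⟩

end Summit.RiemannHypothesis.RiemannHypothesis.Theorems.SignConeConeMagnification

end
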